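import Literature.AlgebraicGeometry.Resolution.LogRegularDomain
import Literature.AlgebraicGeometry.Resolution.RegularLocalRingsNormal
import Literature.AlgebraicGeometry.Resolution.PowerSeriesRegularLocal
import Literature.RingTheory.MvPowerSeries.MonoidPowerSeriesPure
import Literature.RingTheory.Flat.NormalityDescends
import HarnessLib

/-!
# Log regular local rings are normal: the complete case and descent (Kato 1994, Thm. (4.1))

`Literature/AlgebraicGeometry/Resolution/LogRegularCompleteNormal.lean`. K. Kato, *Toric
singularities*, Amer. J. Math. 116 (1994), Thm. (4.1): "Let `(X, M)` be a log. scheme satisfying (S)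
and assume `(X, M)` is regular. Then the scheme `X` is Cohen–Macaulay and is normal." Kato's printed
proof (p. 1079) obtains normality from Cohen–Macaulayness (Hochster) and regularity in codimension
`≤ 1`. We give the NORMALITY half an independent proof along the structure theorem (3.2) already in
the tree (`LogRegularCompleteStructure`, `LogRegularDomain`): `Â ≅ Λ⟦P⟧/(θ)` (or `≅ K⟦P⟧`), and for
`P` PURE in `ℕ^M` (`P = gp(P) ∩ ℕ^M`) the ring `Λ⟦P⟧/(θ)` is a direct summand of the regular local
ring `Λ⟦x₁..x_M⟧/(θ)` (`MonoidPowerSeriesPure`), hence integrally closed; finally normality descends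
along the faithfully flat map `A → Â` (Stacks 033G, tree `NormalityDescends`).

* `isIntegrallyClosed_quotient_span_theta` — `Λ⟦P⟧/(θ)` is an integrally closed domain (`Λ` a DVR
  with uniformizer `π = θ(0)`, `P` pure);
* `isIntegrallyClosed_of_pure_field` — `K⟦P⟧` is an integrally closed domain (`K` a field, `P` pure);
* `isIntegrallyClosed_adicCompletion_of_dform0` — `Â` is an integrally closed domain for d = 0 chart
  data with pure `P`;
* `absorbMonoid_pure` — `P × ℕ^d` is pure when `P` is;
* `isIntegrallyClosed_of_dform` — **a Noetherian local ring with d-form chart data by a pure `P` is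
  an integrally closed domain** (Kato (4.1), normality, complete-structure form).

The passage from an arbitrary fs chart `P ⊆ ℤⁿ` to pure d-form data (a REFLECTING sharp embedding)
and the named fact `Kato1994_logRegularLocal_isIntegrallyClosed` are in the sequel files.

References: [Kato1994] K. Kato, Toric singularities, Amer. J. Math. 116 (1994), Thm. (3.2), Lemma
(3.5), Thm. (4.1); [BrunsGubeladze2009] W. Bruns, J. Gubeladze, Polytopes, Rings, and K-Theory
(2009), Thm. 4.38; [StacksProject, Tag 033G].
-/

noncomputable section

open IsLocalRing MvPowerSeries Literature.RingTheory.MvPowerSeries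
  Literature.RingTheory.MvPowerSeries.monoidPowerSeries
  Literature.RingTheory.CompleteLocalRings

namespace Literature.AlgebraicGeometry.Resolution

namespace LogRegularCompleteStructure

universe u

/-! ### The complete rings `Λ⟦P⟧/(θ)` and `K⟦P⟧` -/

/-- `Λ⟦P⟧/(θ)` is an integrally closed domain when `Λ` is a Noetherian local domain with
`𝔪_Λ = (π)`, `π ≠ 0`, `θ` has constant coefficient `π`, and `P ⊆ ℕ^M` is pure: it is a direct
summand of the regular local ring `Λ⟦T₁,…,T_M⟧/(θ)` (Kato, Lemmas (3.4)–(3.5); Bruns–Gubeladze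
Thm. 4.38). [cite: Kato1994, Thm. (4.1)] -/
theorem isIntegrallyClosed_quotient_span_theta {Λ : Type u} [CommRing Λ] [IsLocalRing Λ] [IsDomain Λ]
    [IsNoetherianRing Λ] {M : ℕ} {P : AddSubmonoid (Fin M →₀ ℕ)}
    (hpure : ∀ a ∈ P, ∀ b : Fin M →₀ ℕ, a + b ∈ P → b ∈ P) {π : Λ} (hπ0 : π ≠ 0)
    (hmax : maximalIdeal Λ = Ideal.span {π}) (θ : monoidPowerSeries Λ P)
    (hθπ : MvPowerSeries.constantCoeff (θ : MvPowerSeries (Fin M) Λ) = π) :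
    IsDomain (monoidPowerSeries Λ P ⧸ Ideal.span {θ}) ∧
      IsIntegrallyClosed (monoidPowerSeries Λ P ⧸ Ideal.span {θ}) := by
  classical
  have hnf : ¬IsField Λ := by
    rw [IsLocalRing.isField_iff_maximalIdeal_eq, hmax, Ideal.span_singleton_eq_bot]; exact hπ0
  have hprinc : (maximalIdeal Λ).IsPrincipal := ⟨⟨π, hmax⟩⟩
  haveI : IsDiscreteValuationRing Λ := ((IsDiscreteValuationRing.TFAE Λ hnf).out 0 4).mpr hprinc
  haveI : IsRegularLocalRing (MvPowerSeries (Fin M) Λ) :=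
    Literature.NumberTheory.GaloisRepresentations.NearlyOrdinaryPresentationCA.isRegularLocalRing_mvPowerSeries_dvr
      Λ M
  have hπm : π ∈ maximalIdeal Λ := hmax ▸ Ideal.subset_span rfl
  have hθm : (θ : MvPowerSeries (Fin M) Λ) ∈ maximalIdeal (MvPowerSeries (Fin M) Λ) := by
    rw [mem_maximalIdeal, mem_nonunits_iff]
    intro hu
    have h := MvPowerSeries.isUnit_constantCoeff _ hu
    rw [hθπ] at h
    exact ((mem_maximalIdeal _).1 hπm) h
  have hθ2 : (θ : MvPowerSeries (Fin M) Λ) ∉ maximalIdeal (MvPowerSeries (Fin M) Λ) ^ 2 :=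
    fun h => generator_not_mem_sq hπ0 hmax (hθπ ▸ constantCoeff_mem_sq_of_mem_sq h)
  haveI : IsRegularLocalRing (MvPowerSeries (Fin M) Λ ⧸
      Ideal.span {(θ : MvPowerSeries (Fin M) Λ)}) :=
    (IsRegularLocalRing.quotient_span_singleton hθm hθ2).1
  haveI : IsDomain (MvPowerSeries (Fin M) Λ ⧸ Ideal.span {(θ : MvPowerSeries (Fin M) Λ)}) :=
    isDomain_of_isRegularLocalRing _
  haveI : IsIntegrallyClosed (MvPowerSeries (Fin M) Λ ⧸ Ideal.span {(θ : MvPowerSeries (Fin M) Λ)}) :=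
    isIntegrallyClosed_of_isRegularLocalRing _
  have hπnzd : MvPowerSeries.constantCoeff (θ : MvPowerSeries (Fin M) Λ) ∈ nonZeroDivisors Λ := by
    rw [hθπ]; exact mem_nonZeroDivisors_of_ne_zero hπ0
  exact isIntegrallyClosed_quotient_of_pure hpure θ hπnzd

/-- `K⟦P⟧` is an integrally closed domain for a field `K` and `P ⊆ ℕ^M` pure: a direct summand
of the regular local ring `K⟦T₁,…,T_M⟧` (Bruns–Gubeladze Thm. 4.35/4.38, completed).
[cite: Kato1994, Thm. (4.1)] -/
theorem isIntegrallyClosed_of_pure_field {K : Type u} [Field K] {M : ℕ}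
    {P : AddSubmonoid (Fin M →₀ ℕ)} (hpure : ∀ a ∈ P, ∀ b : Fin M →₀ ℕ, a + b ∈ P → b ∈ P) :
    IsDomain (monoidPowerSeries K P) ∧ IsIntegrallyClosed (monoidPowerSeries K P) := by
  haveI : IsRegularLocalRing (MvPowerSeries (Fin M) K) := isRegularLocalRing_mvPowerSeries K (Fin M)
  haveI : IsDomain (MvPowerSeries (Fin M) K) := isDomain_of_isRegularLocalRing _
  haveI : IsIntegrallyClosed (MvPowerSeries (Fin M) K) := isIntegrallyClosed_of_isRegularLocalRing _
  exact isIntegrallyClosed_of_pure hpure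

/-! ### `Â` for d = 0 chart data -/

variable {A : Type u} [CommRing A] [IsLocalRing A] [IsNoetherianRing A] {M d : ℕ}
  {P : AddSubmonoid (Fin M →₀ ℕ)} {φ : (Fin M →₀ ℕ) → A}

/-- **`Â` is an integrally closed domain** for a Noetherian local ring with d = 0 chart data by a
PURE monoid (`𝔪 = (φ(P ∖ 0))`, `dim A = rank P`, `P = gp(P) ∩ ℕ^M`): `Â ≅ Λ⟦P⟧/(θ)` or `≅ K⟦P⟧`
by Kato's structure theorem (3.2) (`exists_lift_surjective`, `exists_theta`, `ker_eq_span_theta`,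
`ker_eq_bot_of_field`). [cite: Kato1994, Thm. (4.1)] -/
theorem isIntegrallyClosed_adicCompletion_of_dform0 (hP : P.FG)
    (hpure : ∀ a ∈ P, ∀ b : Fin M →₀ ℕ, a + b ∈ P → b ∈ P) (hφ0 : φ 0 = 1)
    (hφadd : ∀ a ∈ P, ∀ b ∈ P, φ (a + b) = φ a * φ b)
    (hφm : ∀ p ∈ P, p ≠ 0 → φ p ∈ maximalIdeal A)
    (hgen : maximalIdeal A ≤ Ideal.span (φ '' {p | p ∈ P ∧ p ≠ 0}))
    (hdim : ringKrullDim A = rank P) :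
    IsDomain (AdicCompletion (maximalIdeal A) A) ∧
      IsIntegrallyClosed (AdicCompletion (maximalIdeal A) A) := by
  classical
  haveI : IsNoetherianRing (AdicCompletion (maximalIdeal A) A) :=
    isNoetherianRing_adicCompletion_maximalIdeal A
  -- the chart of `Â`
  let φh : (Fin M →₀ ℕ) → AdicCompletion (maximalIdeal A) A := fun p => algebraMap A _ (φ p)
  have hφh0 : φh 0 = 1 := by simp only [φh, hφ0, map_one]
  have hφhadd : ∀ a ∈ P, ∀ b ∈ P, φh (a + b) = φh a * φh b := by
    intro a ha b hb; simp only [φh, hφadd a ha b hb, map_mul]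
  have hφhm : ∀ p ∈ P, p ≠ 0 → φh p ∈ maximalIdeal (AdicCompletion (maximalIdeal A) A) := by
    intro p hp hp0
    rw [AdicCompletion.maximalIdeal_eq_map]
    exact Ideal.mem_map_of_mem _ (hφm p hp hp0)
  have hgenh : maximalIdeal (AdicCompletion (maximalIdeal A) A) ≤
      Ideal.span (φh '' {p | p ∈ P ∧ p ≠ 0}) := by
    rw [AdicCompletion.maximalIdeal_eq_map]
    refine (Ideal.map_mono hgen).trans ?_
    rw [Ideal.map_span, ← Set.image_comp]
    rfl
  have hdimh : ringKrullDim (AdicCompletion (maximalIdeal A) A) = rank P := by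
    rw [ringKrullDim_adicCompletion A, hdim]
  obtain ⟨p, hp⟩ := CharP.exists (ResidueField (AdicCompletion (maximalIdeal A) A))
  rcases CharP.char_is_prime_or_zero (ResidueField (AdicCompletion (maximalIdeal A) A)) p with
    hprime | rfl
  · haveI : Fact p.Prime := ⟨hprime⟩
    obtain ⟨R, _, _, _, hRN, hRc, hmax, hp0, j, hres⟩ :=
      exists_cohenDVR_ringHom (AdicCompletion (maximalIdeal A) A) p
    haveI := hRN
    haveI := hRc
    have hpA : (p : AdicCompletion (maximalIdeal A) A) ∈
        maximalIdeal (AdicCompletion (maximalIdeal A) A) := by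
      rw [← residue_eq_zero_iff, map_natCast]; exact CharP.cast_eq_zero _ p
    haveI : IsLocalHom j := by
      refine ⟨fun r hr => ?_⟩
      by_contra hrn
      have hrm : r ∈ maximalIdeal R := (mem_maximalIdeal _).2 (mem_nonunits_iff.2 hrn)
      rw [hmax, Ideal.mem_span_singleton] at hrm
      obtain ⟨s, rfl⟩ := hrm
      rw [map_mul, map_natCast] at hr
      exact ((mem_maximalIdeal _).1 (Ideal.mul_mem_right _ _ hpA)) hr
    obtain ⟨ψ, hψsurj, hψmon, hψC⟩ := exists_lift_surjective j hres hP φh hφh0 hφhadd hφhm hgenh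
    have hjp : j (p : R) ∈ maximalIdeal _ := by rw [map_natCast]; exact hpA
    obtain ⟨θ, hθ, hθπ⟩ := exists_theta ψ hψsurj j hψC φh hψmon hgenh (p : R) hjp
    have hker := ker_eq_span_theta hp0 hmax hP ψ hψsurj hdimh θ hθ hθπ
    obtain ⟨hdom, hic⟩ := isIntegrallyClosed_quotient_span_theta hpure hp0 hmax θ hθπ
    haveI := hdom
    haveI := hic
    have e : (monoidPowerSeries R P ⧸ RingHom.ker ψ) ≃+* AdicCompletion (maximalIdeal A) A :=
      RingHom.quotientKerEquivOfSurjective hψsurj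
    have e' : (monoidPowerSeries R P ⧸ Ideal.span {θ}) ≃+* AdicCompletion (maximalIdeal A) A :=
      (Ideal.quotEquivOfEq hker.symm).trans e
    exact ⟨e'.symm.injective.isDomain e'.symm.toRingHom,
      IsIntegrallyClosed.of_equiv (R := monoidPowerSeries R P ⧸ Ideal.span {θ}) e'⟩
  · haveI : CharZero (ResidueField (AdicCompletion (maximalIdeal A) A)) := CharP.charP_to_charZero _
    obtain ⟨σ, hσ⟩ := exists_coefficientField_of_charZero (AdicCompletion (maximalIdeal A) A)
    have hbot : maximalIdeal (ResidueField (AdicCompletion (maximalIdeal A) A)) = ⊥ :=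
      (IsLocalRing.isField_iff_maximalIdeal_eq).1 (Field.toIsField _)
    haveI : IsAdicComplete (maximalIdeal (ResidueField (AdicCompletion (maximalIdeal A) A)))
        (ResidueField (AdicCompletion (maximalIdeal A) A)) := by rw [hbot]; infer_instance
    haveI : IsLocalHom σ := by
      refine ⟨fun x hx => ?_⟩
      by_contra hxn
      have hx0 : x = 0 := by by_contra h; exact hxn (Ne.isUnit h)
      rw [hx0, map_zero] at hx
      exact not_isUnit_zero hx
    have hres : ∀ a : AdicCompletion (maximalIdeal A) A, ∃ l, a - σ l ∈ maximalIdeal _ :=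
      fun a => ⟨residue _ a, by rw [← residue_eq_zero_iff, map_sub, hσ, sub_self]⟩
    obtain ⟨ψ, hψsurj, -, -⟩ := exists_lift_surjective σ hres hP φh hφh0 hφhadd hφhm hgenh
    have hker := ker_eq_bot_of_field hP ψ hψsurj hdimh
    obtain ⟨hdom, hic⟩ :=
      isIntegrallyClosed_of_pure_field (K := ResidueField (AdicCompletion (maximalIdeal A) A)) hpure
    haveI := hdom
    haveI := hic
    have hinj : Function.Injective ψ := by
      rw [RingHom.injective_iff_ker_eq_bot]; exact hker
    let e := RingEquiv.ofBijective ψ ⟨hinj, hψsurj⟩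
    exact ⟨e.symm.injective.isDomain e.symm.toRingHom, IsIntegrallyClosed.of_equiv e⟩

/-! ### Descent to `A` -/

/-- `P × ℕ^d ⊆ ℕ^{M+d}` is pure when `P ⊆ ℕ^M` is. [cite: Kato1994, Thm. (3.2)] -/
theorem absorbMonoid_pure (hpure : ∀ a ∈ P, ∀ b : Fin M →₀ ℕ, a + b ∈ P → b ∈ P) :
    ∀ a ∈ absorbMonoid P d, ∀ b : Fin (M + d) →₀ ℕ, a + b ∈ absorbMonoid P d →
      b ∈ absorbMonoid P d := by
  intro a ha b hab
  rw [mem_absorbMonoid] at ha hab ⊢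
  rw [map_add] at hab
  exact hpure _ ha _ hab

/-- **Log regular local rings are normal (d-form, pure chart).** A Noetherian local ring `A` with
chart data `φ : P → A` by a PURE `P ⊆ ℕ^M`, parameters `t₁..t_d` with `𝔪_A = (φ(P ∖ 0)) + (t)`
and `rank P + d ≤ dim A` is an integrally closed domain: `Â ≅ Λ⟦P × ℕ^d⟧/(θ)` is one, and
normality descends along the faithfully flat `A → Â` (Stacks 033G). [cite: Kato1994, Thm. (4.1)] -/
theorem isIntegrallyClosed_of_dform {t : Fin d → A} (hP : P.FG)
    (hpure : ∀ a ∈ P, ∀ b : Fin M →₀ ℕ, a + b ∈ P → b ∈ P) (hφ0 : φ 0 = 1)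
    (hφadd : ∀ a ∈ P, ∀ b ∈ P, φ (a + b) = φ a * φ b)
    (hφm : ∀ p ∈ P, p ≠ 0 → φ p ∈ maximalIdeal A) (ht : ∀ k, t k ∈ maximalIdeal A)
    (hgen : maximalIdeal A ≤ Ideal.span (φ '' {p | p ∈ P ∧ p ≠ 0}) ⊔ Ideal.span (Set.range t))
    (hdim : ((rank P + d : ℕ) : WithBot ℕ∞) ≤ ringKrullDim A) :
    IsDomain A ∧ IsIntegrallyClosed A := by
  have hdim' : ringKrullDim A = rank (absorbMonoid P d) := by
    rw [rank_absorbMonoid]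
    exact le_antisymm (ringKrullDim_le_rank_add hP hφ0 hφadd hφm ht hgen) hdim
  obtain ⟨hdom, hic⟩ := isIntegrallyClosed_adicCompletion_of_dform0 (absorbMonoid_fg hP)
    (absorbMonoid_pure hpure) (absorbChart_zero hφ0 t) (absorbChart_add hφadd t)
    (absorbChart_mem_maximalIdeal hφm ht) (maximalIdeal_le_span_absorbChart hφ0 hgen) hdim'
  haveI := hdom
  haveI := hic
  haveI : Module.FaithfullyFlat A (AdicCompletion (maximalIdeal A) A) :=
    Module.FaithfullyFlat.of_flat_of_isLocalHom
  exact ⟨Literature.RingTheory.Flat.isDomain_of_faithfullyFlat A (AdicCompletion (maximalIdeal A) A),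
    Literature.RingTheory.Flat.isIntegrallyClosed_of_faithfullyFlat A
      (AdicCompletion (maximalIdeal A) A)⟩

end LogRegularCompleteStructure

end Literature.AlgebraicGeometry.Resolution

end
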